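import Summits.QuantumFields.BalabanUV.T4Continuum.Spine.NE4.AutonomousSchemeStable
import Summits.QuantumFields.BalabanUV.T4Continuum.Spine.NE4.KingCurrency
import Mathlib.Analysis.SpecificLimits.Normed

/-!
# Spine/NE4/AutonomousSchemeParabolicMemory — (R55) A COUPLING-SENSITIVE PARABOLIC DIRECTION: King's n-shift input STILL holds, but NE4 AND the
# memory companion (2a) BOTH fail — on the autonomous road the geometric `FadingMemory` that King's route consumes closes (R54)'s parabolic escape as soon
# as the slow direction feels the coupling

Cell `pub-balaban-gaps` (YM blitz G2), seat `ne4`, generation 15 (unit `pub-balaban-gaps-ne4-g15`); record `HOME/ne/NE4.md` §5 (R55).  Sequel of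
`AutonomousSchemeParabolic` ((R54): the coupling-INDEPENDENT parabolic scheme `(1+z)∕(3−z)` satisfies King's β-input and violates NE4, with memory moduli `Λ ≡ 0`).

HONEST FRAMING.  NE4 = `T4CouplingMatching.ScaleShiftRate` is NOT IN PRINT ([Balaban1987RG1] = CMP **109** (1987) p. 264) and NOT proved.  Below: ONE explicit caricature — the
Möbius self-maps `trans g` of the unit disc conjugate (Cayley, `w = (1+z)∕(1−z)`) to the COUPLING-DEPENDENT translations `w ↦ w + (1 + g)` of the right half-plane, i.e. the
one-loop flow `1∕g²_{k+1} = 1∕g²_k + β(g_k)` of [Balaban1987RG1] (0.20) p. 256 with a step that FEELS the coupling — run through the census's hypothesis shapes; elementary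
complex∕real arithmetic and finite sums; nothing of Bałaban's asserted or instantiated; no status word moves (NE4 stays DEPENDENT; spine 0∕9).  One finite T⁴; NOT ℝ⁴, NOT
infinite volume, NOT a mass gap, NOT Clay.

THE POINT.  (R54) separated KING's β-input ((R51): the rate-free n-shift modulus `UniformShift ω → 0`) from NE4 on the autonomous road by a parabolic scheme that does NOT
depend on the coupling — so node U2's OTHER β-side input on King's route, the memory companion (2a) `HistLipschitz Λ ∧ FadingMemory C θ Λ` (GEOMETRIC fading in the age,
consumed by `KingCurrencyWindow`∕`KingCurrencyGap` exactly as by the consecutive kernel), held there trivially (`Λ ≡ 0`).  Does the separation survive when the parabolic direction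
FEELS the coupling, as every direction of Bałaban's RT does?  NO: for `trans g z = ((1+g) + (1−g)z)∕((3+g) − (1+g)z)` (§1: holomorphic self-map of the disc for every `g > 0`,
smooth in `g`) the state after the history `(g_0,…,g_k)` is `S∕(2+S)` with `S = Σ_{i≤k}(1 + g_i)` (§2 `state_transScheme`), the represented family is
`β_{k+1}(g_0,…,g_k) = 1 − 2∕(2 + S)` (`transBeta_eq`); hence (§3) King's n-shift input HOLDS (`uniformShift_transBeta`: `UniformShift (fun j ↦ 2∕(j+3))`, ω → 0) and the family
even has history moduli that are SMALL IN TOTAL (`histLipschitz_transBeta`: the FLAT modulus `Λ k i = 2∕(k+3)²` for every age, total `2(k+1)∕(k+3)² → 0`); but (§4) the moduli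
CANNOT fade geometrically: any `Λ` with `HistLipschitz Λ γ β` has `Λ k 0 ≥ 2∕(2 + (k+1)(1+γ))²` (`modulus_lower_transBeta` — vary the OLDEST coupling), so `FadingMemory C θ Λ` fails for
every `C` and every `θ < 1` (**`not_fadingMemory_transBeta`**), and NE4 fails as in (R54) (**`not_scaleShiftRate_transBeta`**: the scale shift is `≥ 2∕(2+(k+2)(1+γ))²`, polynomial).
READING.  In a coupling-sensitive parabolic direction the dependence on the coupling `g_i` is transported to scale `k` by the SAME non-contracting dynamics that transports the
cutoff: the age profile of the memory is FLAT (polynomially small, uniformly in the age) instead of geometric.  King's route as typed needs GEOMETRIC fading (the growing-envelope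
∕ window bootstraps of `KingCurrencyGap.king_fixedPoint_rateLoss` and `T4CouplingMatching.twoSided_fixedPoint`; (R52)'s note: without the AF binder a summable-but-not-geometric
profile does not close) — so (2a) FAILS here although (1′) holds: (R54)'s parabolic escape from NE4 is open to King's route ONLY in coupling-INSENSITIVE directions.  For an
operation like RT, every direction of which feels the marginal coupling, King's currency and NE4 therefore ask the autonomous road for the SAME thing: no parabolic direction
left after the coupling is extracted — (R53)'s margin.  (What survives of the difference: the flat profile IS summable in the age with total → 0, so a route consuming only
`Σ_i Λ k i → 0` — not typed in the tree; (R52) records that the AF-binder version of the window bootstrap closes with `Σ_age Λ < ∞` — would still separate the currencies.)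

WHAT THIS SAYS FOR THE ROW (census (R55); classification words UNCHANGED): on the autonomous road the memory companion (2a) is a GEOMETRIC-FORGETTING statement in every
coupling-sensitive direction; King's weaker n-shift input (1′) does not weaken what RT must supply there.  NOT PRINTED; nothing of Bałaban's asserted; NE4 NOT proved.
-/

noncomputable section

namespace Summit.QuantumFields.BalabanUV.T4Continuum.Spine.NE4

open Literature.MathematicalPhysics.QuantumFieldTheory.Balaban1983to89
open Literature.MathematicalPhysics.QuantumFieldTheory.Balaban1983to89.FlowStep
open Literature.MathematicalPhysics.QuantumFieldTheory.Balaban1983to89.T4CouplingMatching (ScaleShiftRate HistLipschitz FadingMemory)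
open Literature.MathematicalPhysics.QuantumFieldTheory.Balaban1983to89.T4FlagMemory (extd extd_coe extd_adm extd_tail tail_mem_box Adm)
open Summit.QuantumFields.BalabanUV.T4Continuum.Spine.NE4.KingCurrency (UniformShift)
open Metric Set Filter Topology Finset

namespace Markov

/-! ## §1 The coupling-dependent parabolic self-maps of the disc -/

section Trans

/-- The COUPLING-DEPENDENT PARABOLIC MÖBIUS MAP `trans g z = ((1+g) + (1−g)z)∕((3+g) − (1+g)z)` — the Cayley picture of the translation `w ↦ w + (1+g)` of the right
half-plane (the one-loop flow of `1∕g²` with a coupling-dependent step).  A caricature; NOT Bałaban's RT. [folklore] -/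
def trans (g : ℝ) (z : ℂ) : ℂ := (((1 + g : ℝ) : ℂ) + ((1 - g : ℝ) : ℂ) * z) / (((3 + g : ℝ) : ℂ) - ((1 + g : ℝ) : ℂ) * z)

/-- [bookkeeping] On the unit disc the denominator does not vanish (`g ≥ 0`). [folklore] -/
theorem trans_den_ne_zero {g : ℝ} (hg : 0 ≤ g) {z : ℂ} (hz : ‖z‖ < 1) : ((3 + g : ℝ) : ℂ) - ((1 + g : ℝ) : ℂ) * z ≠ 0 := by
  intro h
  have h1 : ((1 + g : ℝ) : ℂ) * z = ((3 + g : ℝ) : ℂ) := by linear_combination -h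
  have h2 : ‖((1 + g : ℝ) : ℂ) * z‖ = ‖((3 + g : ℝ) : ℂ)‖ := by rw [h1]
  rw [norm_mul, Complex.norm_real, Complex.norm_real, Real.norm_eq_abs, Real.norm_eq_abs, abs_of_nonneg (by linarith),
    abs_of_nonneg (by linarith)] at h2
  have : (1 + g) * ‖z‖ < (1 + g) * 1 := mul_lt_mul_of_pos_left hz (by linarith)
  linarith

/-- **THE DISC IS MAPPED INTO THE DISC** for every `g ≥ 0`: with `a = 1 + g`, `‖(a+2) − a z‖² − ‖a + (2−a)z‖² = 4((a+1) − 2a·re z + (a−1)‖z‖²) ≥ 4(1 − ‖z‖)((a+1) − (a−1)‖z‖) > 0`. [folklore] -/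
theorem norm_trans_lt_one {g : ℝ} (hg : 0 ≤ g) {z : ℂ} (hz : ‖z‖ < 1) : ‖trans g z‖ < 1 := by
  have hden := trans_den_ne_zero hg hz
  have hden' : 0 < ‖((3 + g : ℝ) : ℂ) - ((1 + g : ℝ) : ℂ) * z‖ := norm_pos_iff.2 hden
  rw [trans, norm_div, div_lt_one hden']
  have hre : z.re ≤ ‖z‖ := Complex.re_le_norm z
  have hre' : -‖z‖ ≤ z.re := by
    have := Complex.re_le_norm (-z); rw [norm_neg, Complex.neg_re] at this; linarith
  have hz2 : z.re * z.re + z.im * z.im = ‖z‖ ^ 2 := by rw [Complex.sq_norm, Complex.normSq_apply]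
  have key : ‖((1 + g : ℝ) : ℂ) + ((1 - g : ℝ) : ℂ) * z‖ ^ 2 < ‖((3 + g : ℝ) : ℂ) - ((1 + g : ℝ) : ℂ) * z‖ ^ 2 := by
    rw [Complex.sq_norm, Complex.sq_norm, Complex.normSq_apply, Complex.normSq_apply]
    simp only [Complex.add_re, Complex.add_im, Complex.sub_re, Complex.sub_im, Complex.mul_re, Complex.mul_im, Complex.ofReal_re,
      Complex.ofReal_im, zero_mul, sub_zero, zero_add, add_zero]
    have h0 : 0 < 1 - ‖z‖ := by linarith
    have h1 : 0 < (2 + g) - g * ‖z‖ := by nlinarith [norm_nonneg z]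
    nlinarith [mul_pos h0 h1, norm_nonneg z, hz2]
  exact lt_of_pow_lt_pow_left₀ 2 hden'.le key

/-- Each map is complex-differentiable on the unit disc (`g ≥ 0`). [folklore] -/
theorem differentiableOn_trans {g : ℝ} (hg : 0 ≤ g) : DifferentiableOn ℂ (trans g) (ball (0 : ℂ) 1) := by
  intro z hz
  have hden := trans_den_ne_zero hg (mem_ball_zero_iff.1 hz)
  apply DifferentiableAt.differentiableWithinAt
  unfold trans
  fun_prop (disch := exact hden)

/-- [bookkeeping] **THE ORBIT RECURSION ON REAL POINTS**: `trans g (S∕(2+S)) = (S + 1 + g)∕(2 + (S + 1 + g))` for `S ≥ 0`, `g ≥ 0` — in the half-plane picture `w = 1 + S ↦ w + 1 + g`. [folklore] -/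
theorem trans_orbit_step {g S : ℝ} (hg : 0 ≤ g) (hS : 0 ≤ S) :
    trans g (((S / (2 + S)) : ℝ) : ℂ) = (((S + 1 + g) / (2 + (S + 1 + g)) : ℝ) : ℂ) := by
  have h2 : (2 + S) ≠ 0 := by positivity
  have h3 : (2 + (S + 1 + g)) ≠ 0 := by positivity
  have e : (1 + g + (1 - g) * (S / (2 + S))) / (3 + g - (1 + g) * (S / (2 + S))) = (S + 1 + g) / (2 + (S + 1 + g)) := by
    have e1 : 1 + g + (1 - g) * (S / (2 + S)) = (2 * (1 + g) + 2 * S) / (2 + S) := by field_simp; ring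
    have e2 : 3 + g - (1 + g) * (S / (2 + S)) = (2 * (1 + g) + 4 + 2 * S) / (2 + S) := by field_simp; ring
    have h4 : 2 * (1 + g) + 4 + 2 * S ≠ 0 := by positivity
    rw [e1, e2, div_div_div_cancel_right₀ h2, div_eq_div_iff h4 h3]
    ring
  rw [trans, ← e]
  push_cast
  ring

/-- The COUPLING-DEPENDENT SCHEME «translate by `1 + g` in the half-plane picture». [folklore] -/
def transScheme : ℝ → ℂ → ℂ := fun g z => trans g z

/-- [bookkeeping] The scheme keeps the open unit disc (an invariant set containing the bare state). [folklore] -/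
theorem invariant_transScheme (γ : ℝ) : Invariant transScheme (ball (0 : ℂ) 1) γ :=
  fun _ hg _ _ hz => mem_ball_zero_iff.2 (norm_trans_lt_one hg.le (mem_ball_zero_iff.1 hz))

/-- [bookkeeping] Each step is holomorphic on the disc with values in the disc — (R53)(i)'s shape with margin exactly `q = 1` (parabolic). [folklore] -/
theorem transScheme_holo_self {g : ℝ} (hg : 0 < g) :
    DifferentiableOn ℂ (transScheme g) (ball (0 : ℂ) 1) ∧ MapsTo (transScheme g) (ball (0 : ℂ) 1) (closedBall (0 : ℂ) (1 * 1)) :=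
  ⟨differentiableOn_trans hg.le, fun z hz => by
    rw [one_mul, mem_closedBall_zero_iff]; exact (norm_trans_lt_one hg.le (mem_ball_zero_iff.1 hz)).le⟩

end Trans

/-! ## §2 The state after a history: `S∕(2+S)`, `S = Σ_{i≤k}(1 + g_i)` -/

section Orbit

/-- The half-plane abscissa gained after `n` steps: `trS g n = Σ_{m<n} (1 + g_m)`. [folklore] -/
def trS (g : ℕ → ℝ) (n : ℕ) : ℝ := ∑ m ∈ range n, (1 + g m)

/-- [bookkeeping] `trS g (n+1) = trS g n + (1 + g n)`. [folklore] -/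
theorem trS_succ (g : ℕ → ℝ) (n : ℕ) : trS g (n + 1) = trS g n + (1 + g n) := by
  rw [trS, trS, sum_range_succ]

/-- [bookkeeping] Along nonnegative couplings `n ≤ trS g n`. [folklore] -/
theorem le_trS {g : ℕ → ℝ} (hg : ∀ m, 0 ≤ g m) : ∀ n : ℕ, ((n : ℕ) : ℝ) ≤ trS g n
  | 0 => by simp [trS]
  | n + 1 => by rw [trS_succ]; push_cast; linarith [le_trS hg n, hg n]

/-- [bookkeeping] Along couplings `≤ γ`, `trS g n ≤ n(1+γ)`. [folklore] -/
theorem trS_le {g : ℕ → ℝ} {γ : ℝ} (hg : ∀ m, g m ≤ γ) : ∀ n : ℕ, trS g n ≤ ((n : ℕ) : ℝ) * (1 + γ)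
  | 0 => by simp [trS]
  | n + 1 => by rw [trS_succ]; push_cast; nlinarith [trS_le hg n, hg n]

/-- **THE STATE AFTER `n` STEPS IS `S∕(2+S)`, `S = trS g n`**, along every coupling sequence with nonnegative entries. [folklore] -/
theorem state_transScheme {g : ℕ → ℝ} (hg : ∀ m, 0 ≤ g m) : ∀ n, state transScheme 0 g n = (((trS g n) / (2 + trS g n) : ℝ) : ℂ)
  | 0 => by simp [trS]
  | n + 1 => by
    rw [state_succ, state_transScheme hg n]
    show trans (g n) _ = _
    rw [trans_orbit_step (hg n) ((Nat.cast_nonneg n).trans (le_trS hg n)), trS_succ]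
    congr 1
    ring

/-- The β-family READ OFF the scheme by `re`. [folklore] -/
def transBeta : HBeta := fun k v => (state transScheme 0 (extd v) (k + 1)).re

/-- [bookkeeping] `RepresentsAut transScheme re 0 γ transBeta` — by definition. [folklore] -/
theorem representsAut_transBeta (γ : ℝ) : RepresentsAut transScheme Complex.re 0 γ transBeta := fun _ _ _ => rfl

/-- [bookkeeping] `trS (extd v) (k+1) = Σ_{i : Fin (k+1)} (1 + v_i)`. [folklore] -/
theorem trS_extd {k : ℕ} (v : Fin (k + 1) → ℝ) : trS (extd v) (k + 1) = ∑ i : Fin (k + 1), (1 + v i) := by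
  rw [trS, Finset.sum_range]
  refine Finset.sum_congr rfl fun i _ => ?_
  rw [extd_coe]

/-- **THE REPRESENTED FAMILY**: on the box, `β_{k+1}(v) = 1 − 2∕(2 + Σ_{i≤k}(1 + v_i))`. [folklore] -/
theorem transBeta_eq {γ : ℝ} {k : ℕ} {v : Fin (k + 1) → ℝ} (hv : v ∈ Box γ k) :
    transBeta k v = 1 - 2 / (2 + ∑ i : Fin (k + 1), (1 + v i)) := by
  have hg : ∀ m, 0 ≤ extd v m := fun m => ((extd_adm hv) m).1.le
  rw [transBeta, state_transScheme hg, Complex.ofReal_re, trS_extd]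
  have hpos : 0 < 2 + ∑ i : Fin (k + 1), (1 + v i) := by
    have : 0 ≤ ∑ i : Fin (k + 1), (1 + v i) := Finset.sum_nonneg fun i _ => by linarith [((mem_box.1 hv) i).1]
    linarith
  field_simp
  ring

/-- [bookkeeping] Bounds for the box sums: `k + 1 ≤ Σ_{i≤k}(1 + v_i) ≤ (k+1)(1+γ)`. [folklore] -/
theorem sum_box_bounds {γ : ℝ} {k : ℕ} {v : Fin (k + 1) → ℝ} (hv : v ∈ Box γ k) :
    ((k : ℝ) + 1) ≤ ∑ i : Fin (k + 1), (1 + v i) ∧ ∑ i : Fin (k + 1), (1 + v i) ≤ ((k : ℝ) + 1) * (1 + γ) := by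
  constructor
  · have h : ∑ _i : Fin (k + 1), (1 : ℝ) ≤ ∑ i : Fin (k + 1), (1 + v i) :=
      Finset.sum_le_sum fun i _ => by linarith [((mem_box.1 hv) i).1]
    simpa using h
  · have h : ∑ i : Fin (k + 1), (1 + v i) ≤ ∑ _i : Fin (k + 1), (1 + γ) :=
      Finset.sum_le_sum fun i _ => by linarith [((mem_box.1 hv) i).2]
    have h' : ∑ _i : Fin (k + 1), (1 + γ) = ((k : ℝ) + 1) * (1 + γ) := by
      rw [Finset.sum_const, Finset.card_univ, Fintype.card_fin, nsmul_eq_mul]; push_cast; ring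
    linarith

end Orbit

/-! ## §3 King's n-shift input HOLDS; the memory is FLAT but small in total -/

section King

/-- **KING's INPUT HOLDS**: `UniformShift (fun j ↦ 2∕(j+3)) γ transBeta` — the run with `n` more ultraviolet steps has a LARGER abscissa `S`, and `S ≥ j + 1` at the matched
history, so the two β-functions differ by at most `2∕(2 + S) ≤ 2∕(j+3)`, uniformly in `n` and in the history. [folklore] -/
theorem uniformShift_transBeta (γ : ℝ) : UniformShift (fun j => 2 / ((j : ℝ) + 3)) γ transBeta := by
  intro n j g hg
  -- both histories lie in boxes
  have hbox1 : prefixOf g (j + n) ∈ Box γ (j + n) := mem_box.2 fun i => hg i (by have := i.isLt; omega)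
  have hbox2 : prefixOf (fun i => g (i + n)) j ∈ Box γ j := mem_box.2 fun i => hg (i + n) (by have := i.isLt; omega)
  rw [transBeta_eq hbox1, transBeta_eq hbox2]
  -- the long sum = prefix part + the short sum
  have hsplit : ∑ i : Fin (j + n + 1), (1 + prefixOf g (j + n) i) = (∑ m ∈ range n, (1 + g m)) + ∑ i : Fin (j + 1), (1 + prefixOf (fun i => g (i + n)) j i) := by
    have e1 : ∑ i : Fin (j + n + 1), (1 + prefixOf g (j + n) i) = ∑ m ∈ range (j + n + 1), (1 + g m) := by
      simp only [prefixOf]; exact (Finset.sum_range (fun m => 1 + g m)).symm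
    have e2 : ∑ i : Fin (j + 1), (1 + prefixOf (fun i => g (i + n)) j i) = ∑ m ∈ range (j + 1), (1 + g (m + n)) := by
      simp only [prefixOf]; exact (Finset.sum_range (fun m => 1 + g (m + n))).symm
    rw [e1, e2, show j + n + 1 = n + (j + 1) by ring, Finset.sum_range_add]
    congr 1
    exact Finset.sum_congr rfl fun m _ => by rw [add_comm n m]
  set A : ℝ := ∑ i : Fin (j + 1), (1 + prefixOf (fun i => g (i + n)) j i) with hA
  set P : ℝ := ∑ m ∈ range n, (1 + g m) with hP
  have hA1 : (j : ℝ) + 1 ≤ A := (sum_box_bounds hbox2).1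
  have hP0 : 0 ≤ P := Finset.sum_nonneg fun m hm => by
    have := (hg m (by have := Finset.mem_range.1 hm; omega)).1; linarith
  rw [hsplit]
  have h2 : 0 < 2 + A := by linarith
  have h3 : 0 < 2 + (P + A) := by linarith
  have hmono : 2 / (2 + (P + A)) ≤ 2 / (2 + A) := div_le_div_of_nonneg_left (by norm_num) h2 (by linarith)
  have hb : 0 ≤ 2 / (2 + (P + A)) := by positivity
  have hbound : 2 / (2 + A) ≤ 2 / ((j : ℝ) + 3) := div_le_div_of_nonneg_left (by norm_num) (by positivity) (by linarith)
  rw [show (1 - 2 / (2 + (P + A))) - (1 - 2 / (2 + A)) = 2 / (2 + A) - 2 / (2 + (P + A)) by ring, abs_of_nonneg (sub_nonneg.2 hmono)]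
  linarith

/-- **THE MEMORY IS FLAT BUT SMALL**: `HistLipschitz (fun k _ ↦ 2∕(k+3)²) γ transBeta` — EVERY coupling of the history, whatever its age, moves `β_{k+1}` by at most `2∕(k+3)²`
per unit (total memory `2(k+1)∕(k+3)² → 0`): `β k p − β k q = 2(S_p − S_q)∕((2+S_p)(2+S_q))` with `2 + S ≥ k + 3`. [folklore] -/
theorem histLipschitz_transBeta (γ : ℝ) : HistLipschitz (fun k _ => 2 / ((k : ℝ) + 3) ^ 2) γ transBeta := by
  intro k p q hp hq
  rw [transBeta_eq hp, transBeta_eq hq]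
  set Sp : ℝ := ∑ i : Fin (k + 1), (1 + p i) with hSp
  set Sq : ℝ := ∑ i : Fin (k + 1), (1 + q i) with hSq
  have hp1 : (k : ℝ) + 1 ≤ Sp := (sum_box_bounds hp).1
  have hq1 : (k : ℝ) + 1 ≤ Sq := (sum_box_bounds hq).1
  have h2p : 0 < 2 + Sp := by linarith
  have h2q : 0 < 2 + Sq := by linarith
  have e : (1 - 2 / (2 + Sp)) - (1 - 2 / (2 + Sq)) = 2 * (Sp - Sq) / ((2 + Sp) * (2 + Sq)) := by field_simp; ring
  rw [e, abs_div, abs_mul, abs_mul, abs_of_pos h2p, abs_of_pos h2q, abs_two]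
  show _ ≤ ∑ i : Fin (k + 1), 2 / ((k : ℝ) + 3) ^ 2 * |p i - q i|
  have hdiff : Sp - Sq = ∑ i : Fin (k + 1), (p i - q i) := by
    rw [hSp, hSq, ← Finset.sum_sub_distrib]; exact Finset.sum_congr rfl fun i _ => by ring
  have habs : |Sp - Sq| ≤ ∑ i : Fin (k + 1), |p i - q i| := by rw [hdiff]; exact Finset.abs_sum_le_sum_abs _ _
  have hk3 : 0 < ((k : ℝ) + 3) ^ 2 := by positivity
  have hden : ((k : ℝ) + 3) ^ 2 ≤ (2 + Sp) * (2 + Sq) := by nlinarith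
  rw [← Finset.mul_sum, div_le_iff₀ (by positivity)]
  calc 2 * |Sp - Sq| ≤ 2 * ∑ i : Fin (k + 1), |p i - q i| := by linarith
    _ = 2 / ((k : ℝ) + 3) ^ 2 * (∑ i : Fin (k + 1), |p i - q i|) * ((k : ℝ) + 3) ^ 2 := by
        field_simp
    _ ≤ 2 / ((k : ℝ) + 3) ^ 2 * (∑ i : Fin (k + 1), |p i - q i|) * ((2 + Sp) * (2 + Sq)) := by
        apply mul_le_mul_of_nonneg_left hden
        exact mul_nonneg (by positivity) (Finset.sum_nonneg fun i _ => abs_nonneg _)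

end King

/-! ## §4 … but it cannot FADE geometrically, and NE4 fails -/

section NoFading

/-- **LOWER BOUND ON ANY ADMISSIBLE MODULUS AT THE OLDEST AGE**: if `HistLipschitz Λ γ transBeta` (`γ > 0`) then `2∕(2 + (k+1)(1+γ))² ≤ Λ k 0` — compare the constant history `γ`
with the one whose OLDEST coupling is `γ∕2`: the β-functions differ by `γ∕((2+S_p)(2+S_q)) ≥ (γ∕2)·2∕(2+(k+1)(1+γ))²`. [folklore] -/
theorem modulus_lower_transBeta {γ : ℝ} (hγ : 0 < γ) {Λ : ℕ → ℕ → ℝ} (hL : HistLipschitz Λ γ transBeta) (k : ℕ) :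
    2 / (2 + ((k : ℝ) + 1) * (1 + γ)) ^ 2 ≤ Λ k 0 := by
  set p : Fin (k + 1) → ℝ := fun _ => γ with hpdef
  set q : Fin (k + 1) → ℝ := Function.update p 0 (γ / 2) with hqdef
  have hp : p ∈ Box γ k := mem_box.2 fun _ => ⟨hγ, le_rfl⟩
  have hq : q ∈ Box γ k := mem_box.2 fun i => by
    by_cases hi : i = 0
    · subst hi; simp [hqdef]; constructor <;> linarith
    · rw [hqdef, Function.update_of_ne hi]; exact ⟨hγ, le_rfl⟩
  have h := hL k p q hp hq
  -- right-hand side: only the coordinate 0 differs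
  have hγ2 : |γ - γ / 2| = γ / 2 := by rw [show γ - γ / 2 = γ / 2 by ring, abs_of_pos (half_pos hγ)]
  have hrhs : ∑ i : Fin (k + 1), Λ k i * |p i - q i| = Λ k 0 * (γ / 2) := by
    rw [Finset.sum_eq_single (0 : Fin (k + 1))]
    · simp [hqdef, hpdef, hγ2]
    · intro i _ hi; rw [hqdef, Function.update_of_ne hi]; simp
    · intro h0; exact absurd (Finset.mem_univ _) h0
  rw [hrhs, transBeta_eq hp, transBeta_eq hq] at h
  set Sp : ℝ := ∑ i : Fin (k + 1), (1 + p i) with hSp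
  set Sq : ℝ := ∑ i : Fin (k + 1), (1 + q i) with hSq
  obtain ⟨hp1, hp2⟩ := sum_box_bounds hp
  obtain ⟨hq1, hq2⟩ := sum_box_bounds hq
  have hdiff : Sp - Sq = γ / 2 := by
    have : Sp - Sq = ∑ i : Fin (k + 1), (p i - q i) := by
      rw [hSp, hSq, ← Finset.sum_sub_distrib]; exact Finset.sum_congr rfl fun i _ => by ring
    rw [this, Finset.sum_eq_single (0 : Fin (k + 1))]
    · simp [hqdef, hpdef]; ring
    · intro i _ hi; rw [hqdef, Function.update_of_ne hi]; simp
    · intro h0; exact absurd (Finset.mem_univ _) h0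
  have h2p : 0 < 2 + Sp := by linarith
  have h2q : 0 < 2 + Sq := by linarith
  have e : (1 - 2 / (2 + Sp)) - (1 - 2 / (2 + Sq)) = 2 * (Sp - Sq) / ((2 + Sp) * (2 + Sq)) := by field_simp; ring
  rw [e, hdiff, abs_of_pos (by positivity)] at h
  -- h : 2 * (γ/2) / ((2+Sp)(2+Sq)) ≤ Λ k 0 * (γ/2)
  have hM : (2 + Sp) * (2 + Sq) ≤ (2 + ((k : ℝ) + 1) * (1 + γ)) ^ 2 := by nlinarith
  have hpos : 0 < (2 + Sp) * (2 + Sq) := by positivity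
  have h1 : 2 / (2 + ((k : ℝ) + 1) * (1 + γ)) ^ 2 ≤ 2 / ((2 + Sp) * (2 + Sq)) := div_le_div_of_nonneg_left (by norm_num) hpos hM
  have h2 : 2 / ((2 + Sp) * (2 + Sq)) * (γ / 2) ≤ Λ k 0 * (γ / 2) := by
    rw [show 2 / ((2 + Sp) * (2 + Sq)) * (γ / 2) = 2 * (γ / 2) / ((2 + Sp) * (2 + Sq)) by ring]; exact h
  have h3 := le_of_mul_le_mul_right h2 (half_pos hγ)
  exact h1.trans h3

/-- [bookkeeping] polynomial beats geometric: if `m·(a + (k+1)·b)⁻² ≤ C·θ^k` for all `k` (`m, a, b > 0`, `0 ≤ θ < 1`) — impossible. [folklore] -/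
theorem not_poly_le_geometric {m a b C θ : ℝ} (hm : 0 < m) (ha : 0 < a) (hb : 0 < b) (hθ0 : 0 ≤ θ) (hθ1 : θ < 1)
    (h : ∀ k : ℕ, m / (a + ((k : ℝ) + 1) * b) ^ 2 ≤ C * θ ^ k) : False := by
  have hC : 0 < C := by
    have h0 := h 0
    rw [pow_zero, mul_one] at h0
    have : 0 < m / (a + (((0 : ℕ) : ℝ) + 1) * b) ^ 2 := by positivity
    linarith
  have ht : Tendsto (fun k : ℕ => (k : ℝ) ^ 2 * θ ^ k) atTop (𝓝 0) :=
    tendsto_pow_const_mul_const_pow_of_abs_lt_one 2 (abs_lt.2 ⟨by linarith, hθ1⟩)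
  -- (a + (k+1) b)² ≤ (a + 2b)² k² for k ≥ 1
  set D : ℝ := (a + 2 * b) ^ 2 with hD
  have hDpos : 0 < D := by positivity
  have hev : ∀ᶠ k : ℕ in atTop, (k : ℝ) ^ 2 * θ ^ k < m / (C * D) := ht.eventually (gt_mem_nhds (by positivity))
  obtain ⟨N, hN⟩ := (hev.and (eventually_ge_atTop 1)).exists
  obtain ⟨hsmall, hN1⟩ := hN
  have hN1' : (1 : ℝ) ≤ N := by exact_mod_cast hN1
  have hpoly : (a + ((N : ℝ) + 1) * b) ^ 2 ≤ D * (N : ℝ) ^ 2 := by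
    rw [hD, ← mul_pow]
    apply pow_le_pow_left₀ (by positivity)
    nlinarith
  have h1 := h N
  have hden : 0 < (a + ((N : ℝ) + 1) * b) ^ 2 := by positivity
  -- m ≤ C θ^N (a+(N+1)b)² ≤ C θ^N D N² < m
  have h2 : m ≤ C * θ ^ N * (a + ((N : ℝ) + 1) * b) ^ 2 := by
    have := (div_le_iff₀ hden).1 h1; linarith
  have hθN : 0 ≤ θ ^ N := pow_nonneg hθ0 N
  have h3 : C * θ ^ N * (a + ((N : ℝ) + 1) * b) ^ 2 ≤ C * θ ^ N * (D * (N : ℝ) ^ 2) := mul_le_mul_of_nonneg_left hpoly (by positivity)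
  have h4 : C * θ ^ N * (D * (N : ℝ) ^ 2) = C * D * ((N : ℝ) ^ 2 * θ ^ N) := by ring
  have h5 : C * D * ((N : ℝ) ^ 2 * θ ^ N) < C * D * (m / (C * D)) := mul_lt_mul_of_pos_left hsmall (by positivity)
  rw [mul_div_cancel₀ _ (by positivity : C * D ≠ 0)] at h5
  linarith

/-- **THE MEMORY COMPANION (2a) FAILS**: for `γ > 0`, NO history moduli `Λ` with `HistLipschitz Λ γ transBeta` can satisfy `FadingMemory C θ Λ` with `0 ≤ θ < 1` — the dependence
on the OLDEST coupling is `≥ 2∕(2+(k+1)(1+γ))²`, polynomial in the age, never geometric.  King's n-shift input holds (§3); King's ROUTE (which consumes geometric fading) does not close. [folklore] -/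
theorem not_fadingMemory_transBeta {γ C θ : ℝ} (hγ : 0 < γ) (hθ0 : 0 ≤ θ) (hθ1 : θ < 1) {Λ : ℕ → ℕ → ℝ}
    (hL : HistLipschitz Λ γ transBeta) : ¬ FadingMemory C θ Λ := by
  intro hF
  refine not_poly_le_geometric (m := 2) (a := 2) (b := 1 + γ) (C := C) two_pos two_pos (by linarith) hθ0 hθ1 fun k => ?_
  have h1 := modulus_lower_transBeta hγ hL k
  have h2 : Λ k 0 ≤ C * θ ^ (k - 0) := (hF k 0 (Nat.zero_le k)).2
  rw [Nat.sub_zero] at h2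
  exact h1.trans h2

/-- **NE4 FAILS** (`γ > 0`, `0 ≤ θ < 1`, all `c`): the scale shift `β (k+1) w − β k (tail w) = 2(1 + w_0)∕((2+S_tail)(2+S_w)) ≥ 2∕(2+(k+2)(1+γ))²` is polynomial. [folklore] -/
theorem not_scaleShiftRate_transBeta {γ θ : ℝ} (hγ : 0 < γ) (hθ0 : 0 ≤ θ) (hθ1 : θ < 1) (c : ℝ) : ¬ ScaleShiftRate c θ γ transBeta := by
  intro hS
  refine not_poly_le_geometric (m := 2) (a := 2 + (1 + γ)) (b := 1 + γ) (C := c) two_pos (by linarith) (by linarith) hθ0 hθ1 fun k => ?_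
  set w : Fin (k + 2) → ℝ := fun _ => γ with hwdef
  have hw : w ∈ Box γ (k + 1) := mem_box.2 fun _ => ⟨hγ, le_rfl⟩
  have h := hS k w hw
  rw [transBeta_eq hw, transBeta_eq (tail_mem_box hw)] at h
  have hSw : ∑ i : Fin (k + 1 + 1), (1 + w i) = ((k : ℝ) + 2) * (1 + γ) := by
    simp only [hwdef, Finset.sum_const, Finset.card_univ, Fintype.card_fin, nsmul_eq_mul]; push_cast; ring
  have hSt : ∑ i : Fin (k + 1), (1 + Fin.tail w i) = ((k : ℝ) + 1) * (1 + γ) := by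
    simp only [hwdef, Fin.tail, Finset.sum_const, Finset.card_univ, Fintype.card_fin, nsmul_eq_mul]; push_cast; ring
  rw [hSw, hSt] at h
  have h2 : 0 < 2 + ((k : ℝ) + 1) * (1 + γ) := by positivity
  have h3 : 0 < 2 + ((k : ℝ) + 2) * (1 + γ) := by positivity
  have e : (1 - 2 / (2 + ((k : ℝ) + 2) * (1 + γ))) - (1 - 2 / (2 + ((k : ℝ) + 1) * (1 + γ)))
      = 2 * (1 + γ) / ((2 + ((k : ℝ) + 1) * (1 + γ)) * (2 + ((k : ℝ) + 2) * (1 + γ))) := by field_simp; ring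
  rw [e, abs_of_pos (by positivity)] at h
  -- 2/(2+(1+γ)+(k+1)(1+γ))² ≤ 2(1+γ)/((2+(k+1)(1+γ))(2+(k+2)(1+γ)))
  have hγ1 : 1 ≤ 1 + γ := by linarith
  have hprod : (2 + ((k : ℝ) + 1) * (1 + γ)) * (2 + ((k : ℝ) + 2) * (1 + γ)) ≤ (2 + (1 + γ) + ((k : ℝ) + 1) * (1 + γ)) ^ 2 := by nlinarith
  have hpos : 0 < (2 + ((k : ℝ) + 1) * (1 + γ)) * (2 + ((k : ℝ) + 2) * (1 + γ)) := by positivity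
  calc 2 / (2 + (1 + γ) + ((k : ℝ) + 1) * (1 + γ)) ^ 2 ≤ 2 / ((2 + ((k : ℝ) + 1) * (1 + γ)) * (2 + ((k : ℝ) + 2) * (1 + γ))) :=
        div_le_div_of_nonneg_left (by norm_num) hpos hprod
    _ ≤ 2 * (1 + γ) / ((2 + ((k : ℝ) + 1) * (1 + γ)) * (2 + ((k : ℝ) + 2) * (1 + γ))) := by
        apply div_le_div_of_nonneg_right _ hpos.le; linarith
    _ ≤ c * θ ^ k := h

/-- [bookkeeping] … hence no orbit-stability constants on the invariant disc either (else (R42)'s `scaleShiftRate_of_stable` would give NE4; the read-out `re` is 1-Lipschitz, first step ≤ 1). [folklore] -/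
theorem not_orbitStability_transScheme {γ θ C : ℝ} (hγ : 0 < γ) (hC : 0 ≤ C) (hθ0 : 0 ≤ θ) (hθ1 : θ < 1) :
    ¬ OrbitStability transScheme (ball (0 : ℂ) 1) C θ γ := fun hst =>
  not_scaleShiftRate_transBeta hγ hθ0 hθ1 (1 * C * 1 * θ)
    (scaleShiftRate_of_stable (invariant_transScheme γ) (mem_ball_self one_pos) hst
      (fun g hg _ => by
        rw [dist_zero_right]
        exact (norm_trans_lt_one hg.le (by simp)).le)
      hC hθ0 zero_le_one (representsAut_transBeta γ)
      (fun x _ x' _ => by rw [one_mul, dist_eq_norm, ← Complex.sub_re]; exact Complex.abs_re_le_norm _))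

end NoFading

end Markov

end Summit.QuantumFields.BalabanUV.T4Continuum.Spine.NE4

end
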